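import Summits.Parity.GeneralizedHardyLittlewood.Theorems.PrimeLevelFamEdgeMomentsBeyondDiagonalDiagRemTwoTwoEstimate
import Summits.Parity.GeneralizedHardyLittlewood.Theorems.PrimeLevelFamEdgeMomentsBeyondDiagonalDiagDecorOrderTwoTwoTarget
import HarnessLib

/-!
# Route `PrimeLevelFamEdge`, crux K_A `MomentsBeyondDiagonal` (stmt-Parity-20007), line «petersson_layers» v4, stub `stub_diag`:
# **RUNG `N = 2` OF `stub_diag` IS UNCONDITIONAL** — the diagonal main term for every admissible `P` and every `Q` of degree `≤ 2`

Composition of `…DiagRemTwoTwoEstimate.remainder_estimate₂₂` ((R₂₂), this lineage) with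
`…DiagRungTwoOfR22.diagPart_asymp_of_natDegree_le_two_of_remainder` ((Poly₂₂)/(M4), lineage famedge-2, p830190) and
`…DiagDecorOrderTwoTwoTarget.orderTwoTwo_target_of_remainder` (p830303):

* `orderTwoTwo_target` — **the order-`(2,2)` target of `…DiagOrderSelberg.subDiag_of_selbergOrderAsymptotics(_of_le)`
  (`τ₂₂(Δ′,P) = Δ′⁴·(π²/6)²(Φ₅/160 − Ψ₃/24 + (3/16)Ξ₁)(1/Δ′,P)/(2(π²/6)²)`) on every window `(1, Δ]`, `Δ ≤ 3/2`,
  with NO hypothesis left;**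
* `diagPart_asymp_of_natDegree_le_two` — **RUNG `N = 2`: for every admissible `P`, every `Q` with `deg Q ≤ 2` and every
  `Δ′ ∈ (1, 3/2]`: `‖diagPart q P Q Δ′ − 2ζ(2)²q̂/(Δ′²ℓ²)(Q₀²·secondMomentForm Δ′ P 1 + 2Q₁²τ₁₁ + 4Q₀Q₂τ₀₂ + 2Q₂²τ₂₂)‖
  ≤ C q̂ ℓ⁻³` for `q ≥ q₀`, unconditionally.**

With orders `(0,0)` (`…DiagOrderZero`), `(1,1)` (`…DiagRemEstimate`), `(0,2)`/`(2,0)` (`…DiagRemZeroTwoEstimate`, `…DiagOrderSymm`)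
all orders `(i,j)` with `max(i,j) ≤ 2` of `stub_diag` are now theorems. Def-free; theorems only. Helper
`--supports stmt-Parity-20007`; closes nothing (`stub_diag : SubDiag` needs every rung `N`; orders with `max(i,j) ≥ 3` and
`stub_rung/core/band/identP` remain); K_A, K_B and the Parity summit are NOT proved; nothing about Landau–Siegel zeros.

## References
* E. Kowalski, P. Michel, J. VanderKam, J. reine angew. Math. 526 (2000), (23)–(28) pp. 13–15, Prop. 5.1 (31) p. 18.
  [cite: KowalskiMichelVanderKam2000, (23)–(28) pp. 13–15 — derivation (diagonal main term, Q of degree ≤ 2)]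
-/

noncomputable section

open scoped Real ArithmeticFunction.Moebius
open Complex MeasureTheory Polynomial Finset ArithmeticFunction Set intervalIntegral
open Literature.NumberTheory.LFunctions Literature.NumberTheory.LFunctions.KMV2000

namespace Summit.Parity.GeneralizedHardyLittlewood.Theorems.MomentsBeyondDiagonal.DiagCorner

open Summit.Parity.GeneralizedHardyLittlewood.Theorems.PrimeLevelFamEdgeIdeaDeltas.PeterssonLayers (diagPart)
open Summit.Parity.GeneralizedHardyLittlewood.Theorems.MomentsBeyondDiagonal.DiagKernel (orderTwoTwo_target_of_remainder)
open Summit.Parity.GeneralizedHardyLittlewood.Theorems.MomentsBeyondDiagonal.DiagLines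
  (diagPart_asymp_of_natDegree_le_two_of_remainder)

set_option maxHeartbeats 800000 in
-- large statement
/-- **THE ORDER-`(2,2)` TARGET OF `stub_diag`, UNCONDITIONAL** (window `(1, Δ]`, any `Δ ≤ 3/2`).
[cite: KowalskiMichelVanderKam2000, (23)–(28) and Prop. 5.1 — derivation (order-(2,2) piece of the diagonal, general Q)] -/
theorem orderTwoTwo_target {Δ : ℝ} (hΔ : Δ ≤ 3 / 2) :
    ∀ P : ℝ[X], KMV2000.Admissible P → ∀ Δ' : ℝ, 1 < Δ' → Δ' ≤ Δ →
      ∃ C : ℝ, ∃ q₀ : ℕ, ∀ (q : ℕ) [NeZero q], q₀ ≤ q →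
        |(Real.log (qhat q))⁻¹ ^ (2 + 2) * qhat q *
          (∑ c ∈ Icc 1 ⌊qhat q ^ Δ'⌋₊, ∑ g ∈ Icc 1 (⌊qhat q ^ Δ'⌋₊ / c), (μ g : ℝ) * c *
        ∑ k₁ ∈ Icc 1 (⌊qhat q ^ Δ'⌋₊ / (c * g)), ∑ k₂ ∈ Icc 1 (⌊qhat q ^ Δ'⌋₊ / (c * g)),
          ((μ (c * g * k₁) : ℝ) * ((psi (c * g * k₁))⁻¹ *
              P.eval (Real.log (qhat q ^ Δ' / ((c * g * k₁ : ℕ) : ℝ)) / Real.log (qhat q ^ Δ'))) / ((c * g * k₁ : ℕ) : ℝ)) *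
            ((μ (c * g * k₂) : ℝ) * ((psi (c * g * k₂))⁻¹ *
              P.eval (Real.log (qhat q ^ Δ' / ((c * g * k₂ : ℕ) : ℝ)) / Real.log (qhat q ^ Δ'))) / ((c * g * k₂ : ℕ) : ℝ)) *
            (∑ d ∈ k₁.divisors, ∑ e ∈ k₂.divisors,
              ∫ u₁ in Ioi (0 : ℝ),
                (Real.log (qhat q / ((k₁ / d * (g * e) : ℕ) : ℝ)) + Real.log u₁) ^ 2 *
                ∫ u₂ in Ioi ((((k₁ / d * (g * e) * (g * d * (k₂ / e)) : ℕ) : ℝ) / qhat q ^ 2) / u₁),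
                  Real.exp (-(u₁ + u₂)) / (1 - Real.exp (-(u₁ + u₂))) ^ 2 *
                  (Real.log (qhat q / ((g * d * (k₂ / e) : ℕ) : ℝ)) + Real.log u₂) ^ 2)) -
          2 * (π ^ 2 / 6) ^ 2 * (qhat q / (Δ' ^ 2 * Real.log (qhat q) ^ 2)) *
            (Δ' ^ 2 * (Δ' ^ 2 *
              ((π ^ 2 / 6) ^ 2 * ((∑ j ∈ Finset.range (5 + 1), ∑ i ∈ Finset.range (j + 1),
            ((5 : ℕ).choose j : ℝ) * (j.choose i : ℝ) * 2 ^ (5 - j) *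
              ∫ u in (0 : ℝ)..1, (((Polynomial.C (1 / Δ') - X) ^ (5 - j) * derivative (derivative (X ^ i * P))) *
                derivative (derivative (X ^ (j - i) * P))).eval u) / 160 -
          (∑ j ∈ Finset.range (3 + 1), ∑ i ∈ Finset.range (j + 1),
            ((3 : ℕ).choose j : ℝ) * (j.choose i : ℝ) * 2 ^ (3 - j) *
              ∫ u in (0 : ℝ)..1, (((Polynomial.C (1 / Δ') - X) ^ (3 - j) * (-(2 : ℝ) • (X ^ i * P))) *
                derivative (derivative (X ^ (j - i) * P))).eval u) / 24 +
          3 / 16 * (∑ j ∈ Finset.range (1 + 1), ∑ i ∈ Finset.range (j + 1),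
            ((1 : ℕ).choose j : ℝ) * (j.choose i : ℝ) * 2 ^ (1 - j) *
              ∫ u in (0 : ℝ)..1, (((Polynomial.C (1 / Δ') - X) ^ (1 - j) * (-(2 : ℝ) • (X ^ i * P))) *
                (-(2 : ℝ) • (X ^ (j - i) * P))).eval u)))) / (2 * (π ^ 2 / 6) ^ 2))| ≤
          C * qhat q * (Real.log (qhat q))⁻¹ ^ 3 := by
  refine orderTwoTwo_target_of_remainder (Δ := Δ) ?_
  obtain ⟨E₀₀, E₀₁, E₁₀, E₀₂, E₂₀, E₁₁, E₁₂, E₂₁, E₂₂, μ₂, μ₄, h⟩ := remainder_estimate₂₂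
  exact ⟨E₀₀, E₀₁, E₁₀, E₀₂, E₂₀, E₁₁, E₁₂, E₂₁, E₂₂, μ₂, μ₄, fun P hP Δ' h1 h2 ↦ h P hP Δ' h1 (h2.trans hΔ)⟩

set_option maxHeartbeats 800000 in
-- large statement
/-- **RUNG `N = 2` OF `stub_diag`, UNCONDITIONAL**: for every admissible `P`, every `Q` with `deg Q ≤ 2` and every
`Δ′ ∈ (1, 3/2]`, the diagonal main term with error `O(q̂ℓ⁻³)` (see the module docstring).
[cite: KowalskiMichelVanderKam2000, (23)–(28) pp. 13–15, Prop. 5.1 (31) — derivation (diagonal main term, Q of degree ≤ 2)] -/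
theorem diagPart_asymp_of_natDegree_le_two
    {P Q : ℝ[X]} (hP : KMV2000.Admissible P) (hQ : Q.natDegree ≤ 2) {Δ' : ℝ} (h1 : 1 < Δ') (h32 : Δ' ≤ 3 / 2) :
    ∃ C : ℝ, ∃ q₀ : ℕ, ∀ (q : ℕ) [NeZero q], q₀ ≤ q →
      ‖diagPart q P Q Δ' -
          ((2 * riemannZeta 2 ^ 2 *
              ((qhat q / (Δ' ^ 2 * Real.log (qhat q) ^ 2) : ℝ) : ℂ)) *
            ((Q.coeff 0 ^ 2 * KMV2000.secondMomentForm Δ' P 1 +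
              2 * Q.coeff 1 ^ 2 *
                (Δ' ^ 2 * ((π ^ 2 / 6) ^ 2 *
              ((∑ j ∈ Finset.range (3 + 1), ∑ i ∈ Finset.range (j + 1),
                  ((3 : ℕ).choose j : ℝ) * (j.choose i : ℝ) * 2 ^ (3 - j) *
                    ∫ u in (0 : ℝ)..1, (((Polynomial.C (1 / Δ') - X) ^ (3 - j) *
                      derivative (derivative (X ^ i * P))) * derivative (derivative (X ^ (j - i) * P))).eval u) / 24 -
                (∑ j ∈ Finset.range (1 + 1), ∑ i ∈ Finset.range (j + 1),
                  ((1 : ℕ).choose j : ℝ) * (j.choose i : ℝ) * 2 ^ (1 - j) *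
                    ∫ u in (0 : ℝ)..1, (((Polynomial.C (1 / Δ') - X) ^ (1 - j) * (-(2 : ℝ) • (X ^ i * P))) *
                      derivative (derivative (X ^ (j - i) * P))).eval u) / 4)) / (2 * (π ^ 2 / 6) ^ 2)) +
              4 * (Q.coeff 0 * Q.coeff 2) *
                (Δ' ^ 2 * ((π ^ 2 / 6) ^ 2 *
              ((∑ j ∈ Finset.range (3 + 1), ∑ i ∈ Finset.range (j + 1),
                  ((3 : ℕ).choose j : ℝ) * (j.choose i : ℝ) * 2 ^ (3 - j) *
                    ∫ u in (0 : ℝ)..1, (((Polynomial.C (1 / Δ') - X) ^ (3 - j) *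
                      derivative (derivative (X ^ i * P))) * derivative (derivative (X ^ (j - i) * P))).eval u) / 24 +
                (∑ j ∈ Finset.range (1 + 1), ∑ i ∈ Finset.range (j + 1),
                  ((1 : ℕ).choose j : ℝ) * (j.choose i : ℝ) * 2 ^ (1 - j) *
                    ∫ u in (0 : ℝ)..1, (((Polynomial.C (1 / Δ') - X) ^ (1 - j) * (-(2 : ℝ) • (X ^ i * P))) *
                      derivative (derivative (X ^ (j - i) * P))).eval u) / 4)) / (2 * (π ^ 2 / 6) ^ 2)) +
              2 * Q.coeff 2 ^ 2 *
                (Δ' ^ 2 * (Δ' ^ 2 *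
                  ((π ^ 2 / 6) ^ 2 * ((∑ j ∈ Finset.range (5 + 1), ∑ i ∈ Finset.range (j + 1),
            ((5 : ℕ).choose j : ℝ) * (j.choose i : ℝ) * 2 ^ (5 - j) *
              ∫ u in (0 : ℝ)..1, (((Polynomial.C (1 / Δ') - X) ^ (5 - j) * derivative (derivative (X ^ i * P))) *
                derivative (derivative (X ^ (j - i) * P))).eval u) / 160 -
          (∑ j ∈ Finset.range (3 + 1), ∑ i ∈ Finset.range (j + 1),
            ((3 : ℕ).choose j : ℝ) * (j.choose i : ℝ) * 2 ^ (3 - j) *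
              ∫ u in (0 : ℝ)..1, (((Polynomial.C (1 / Δ') - X) ^ (3 - j) * (-(2 : ℝ) • (X ^ i * P))) *
                derivative (derivative (X ^ (j - i) * P))).eval u) / 24 +
          3 / 16 * (∑ j ∈ Finset.range (1 + 1), ∑ i ∈ Finset.range (j + 1),
            ((1 : ℕ).choose j : ℝ) * (j.choose i : ℝ) * 2 ^ (1 - j) *
              ∫ u in (0 : ℝ)..1, (((Polynomial.C (1 / Δ') - X) ^ (1 - j) * (-(2 : ℝ) • (X ^ i * P))) *
                (-(2 : ℝ) • (X ^ (j - i) * P))).eval u)))) / (2 * (π ^ 2 / 6) ^ 2)) : ℝ) : ℂ))‖ ≤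
        C * qhat q * (Real.log (qhat q))⁻¹ ^ 3 :=
  diagPart_asymp_of_natDegree_le_two_of_remainder remainder_estimate₂₂ hP hQ h1 h32

end Summit.Parity.GeneralizedHardyLittlewood.Theorems.MomentsBeyondDiagonal.DiagCorner

end
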